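import Summits.BirchSwinnertonDyer.BirchSwinnertonDyer.Theorems.ThetaPartnerAtTwoSignedControlAtTwoRelaxedKummerCount
import Summits.BirchSwinnertonDyer.BirchSwinnertonDyer.Theorems.ThetaPartnerAtTwoSignedControlAtTwoH1SigmaLocalBounds
import Literature.NumberTheory.EllipticCurves.SubgroupSelmerCocycleCriteriaProofs
import Literature.Barriers.BirchSwinnertonDyer.DescentDefectUnboundedMatsunoCor33Proofs
import Literature.NumberTheory.EllipticCurves.IwasawaCoinvariantsRankProofs
import Literature.NumberTheory.EllipticCurves.IwasawaSelmerProofs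
import Literature.NumberTheory.EllipticCurves.SubgroupSelmerProofs
import HarnessLib

/-!
# (I1) AT LEVEL 0 FROM POITOU–TATE: the relaxed finite-level Selmer count
# `relaxedSelmer_torsion_card_growth` at the bottom layer `n = 0`, over ANY number field, in its own currency

Route `ThetaPartnerAtTwo` (TP2), crux K4 `SignedControlAtTwo` (stmt-BirchSwinnertonDyer-20309), line `eulerchar` v8
(stub `stub_pubGreenbergNTTwo`, third conjunct Greenberg Thm. 1.7 = tree assembly of (I1) + (I2)); width seat
`bsd-wall-tp2-p3-w2` g4 (`--supports stmt-BirchSwinnertonDyer-20309`, helper). Sequel of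
`…SignedControlAtTwoRelaxedKummerCount` (Part A: `#𝓛_𝔮 ≤ #H¹_{𝓛, ⊤ at 𝔮 and ∞}(K, E[p^k])` from
`poitouTate_selmerStructure_duality K`). Programme «(I1) ⟸ Poitou–Tate», Part B.

## What is proved (theorems only; `K : Type` any number field, `E = W` elliptic, `p` prime)

* `natCard_kummerSelmerStructure_le_natCard_kummerOutside_singleton_mul` —
  **`#𝓛_𝔮 ≤ #H¹_{𝓛, ⊤ at 𝔮}(K, E[p^k]) · ∏_{w∣∞} #H¹(K_w, E(K̄_w))`** (`k ≥ 1`, any finite `𝔮`): the Kummer condition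
  imposed ALSO at the archimedean places — the archimedean Kummer defects of a class of `H¹_{𝓛, ⊤ at 𝔮 and ∞}` live
  in `∏_{w∣∞} H¹(K_w, E)`, FINITE groups (tree `H1SigmaCorank.finite_localH1_infinitePlace`, killed by `2`), so the
  correction is a constant INDEPENDENT of `k` (it matters only through real places, i.e. at `p = 2`); and
  `prime_pow_le_natCard_kummerOutside_singleton_mul`: **`p^k ≤ #kummerOutside W (p^k) {𝔮} · ∏_{w∣∞} #H¹(K_w, E)`**
  at `𝔮 ∣ p`.
* `finite_ker_resH1Hom_inclusion_and_natCard_le` — **`#ker(H¹(K, E[p^M]) → H¹(K, E[p^∞])) ≤ #E(K̄)[p^∞]^{Γ_K}`**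
  (and the kernel is finite): `[φ] ↦ p^M a` (`φ = ∂a` in `E[p^∞]`) injects the kernel into the FINITE
  (`finite_fixedPoints_geomPrimaryTorsion`) fixed points; the general form of the tree's injectivity statement
  `torsionPowToPrimaryH1_injective` (which needs `E(K̄)[p^∞]^{Γ_K} = 0`). No hypothesis on `E(K)[p]`.
* `resH1Hom_inclusion_mem_selmerLocalKerPrimary` — the Kummer condition at a `K`-field passes from level `p^M` to
  `E[p^∞]` (functoriality `resH1Hom_comp`).
* `relaxedSelmer_torsion_card_levelZero_of_poitouTate` — **the `n = 0` case of (I1)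
  `WeierstrassCurve.relaxedSelmer_torsion_card_growth` VERBATIM in its currency**
  (`W.subgroupH1 p (κ.layerSubgroup 0)`, `conjH1`, `localKerOver`, all conjugates, all finite `u ≠ v` and all
  infinite `w`), for EVERY number field `K`, every `ℤ_p`-extension `κ`, every `v ∋ p`, GIVEN
  `poitouTate_selmerStructure_duality K`: `∃ c, ∀ k, ∃ F, (…) ∧ p^{k·p⁰} ≤ c·#F`. Here `F` = the image of
  `kummerOutside W (p^k) {v}` under `H¹(K, E[p^k]) → H¹(K, E[p^∞]) ⥲ H¹(⊤, E[p^∞]) → H¹(κ.layerSubgroup 0, E[p^∞])`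
  (last two maps injective), so `#F ≥ #kummerOutside / #E(K̄)[p^∞]^{Γ_K}`; `c = #E(K̄)[p^∞]^{Γ_K} · ∏_{w∣∞} #H¹(K_w, E)`.
  Local conditions: `resH1Hom_subgroupIncl_mem_localKerOver_top_iff`, `resOfLe_mem_localKerOver`, and `conj_σ = id` on
  `H¹(κ.layerSubgroup 0, ·)` (`conjH1_of_mem_holds`; every `σ` lies in `κ.layerSubgroup 0 = κ⁻¹(p⁰ℤ_p) = Γ_K`).

WHAT IS LEFT OF (I1) after this file: the layers `n ≥ 1` — the SAME count over the number field `K_n = K̄^{κ⁻¹(pⁿℤ_p)}`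
(Part A applies to `K_n` verbatim) followed by a TRANSPORT `H¹(Γ_{K_n}, E_{K_n}[p^∞]) ≅ W.subgroupH1 p (κ.layerSubgroup n)`
matching the places of `K_n` above `u` with the `Γ_K`-conjugates of `localKerOver p (κ.layerSubgroup n) K_u`, and
`∑_{w ∣ v} [K_{n,w} : ℚ_p] = pⁿ [K_v : ℚ_p]` — Galois-theoretic base-change plumbing in the tree's subgroup model, no
further arithmetic duality.

HONEST FRAMING: THEOREMS ONLY (no definition, no named fact, no `sorry`), CONDITIONAL on the named fact
`poitouTate_selmerStructure_duality K` as a hypothesis; proves the level-`0` instance of (I1), NOT (I1); closes nothing;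
BSD is not proved by any of this.

References: [cite: GreenbergLNM1716, Thm 1.7 (pp. 61–62), §2 (pp. 62–63), §3 Lemma 3.1, §4 pp. 105–106]
[cite: MilneADT2006, Ch. I, Lemma 3.3, Rem. 3.7, Thm. 4.10] [cite: NeukirchSchmidtWingberg2008, (8.7.9)] [cite: WZhang2014, p. 248].
-/

set_option linter.dupNamespace false

noncomputable section
open scoped Classical
open CategoryTheory Field NumberField IsDedekindDomain Function
open Literature.NumberTheory.EllipticCurves Literature.NumberTheory.EllipticCurves.GreenbergSelmer
open Literature.NumberTheory.GaloisRepresentations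
open Literature.NumberTheory.GaloisRepresentations.DiscreteGaloisModule (SelmerStructure tateDual)
open Literature.NumberTheory.GaloisCohomology
open scoped ContRepresentation
namespace Summit.BirchSwinnertonDyer.BirchSwinnertonDyer.Theorems.SignedEC.RelaxedKummerCount

open Summit.BirchSwinnertonDyer.Rank1Residual.X11b.KummerPT Summit.BirchSwinnertonDyer.Rank1Residual.X11b.LocBridge
  Summit.BirchSwinnertonDyer.Rank1Residual.X11b.Levels Summit.BirchSwinnertonDyer.Rank1Residual.X11b.AcSelmer
  Summit.BirchSwinnertonDyer.Rank1Residual.X11b.SelmerLevelBound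

variable {K : Type} [Field K] [NumberField K] (W : WeierstrassCurve K) [W.IsElliptic] (p k : ℕ)
  [Fact p.Prime]

/-! ## Imposing the Kummer condition at the archimedean places too -/

/-- Counting along a homomorphism: `#A ≤ #ker f · #B` for `f : A →+ B` with `B` and `ker f` finite
(`#A = #ker f · #im f`). [folklore] -/
theorem natCard_le_natCard_ker_mul {A B : Type*} [AddCommGroup A] [AddCommGroup B] [Finite B]
    (f : A →+ B) [Finite f.ker] : Nat.card A ≤ Nat.card f.ker * Nat.card B := by
  haveI : Finite A := by
    rw [AddMonoidHom.finite_iff_finite_ker_range f]; exact ⟨inferInstance, inferInstance⟩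
  rw [← AddSubgroup.card_mul_index f.ker, AddSubgroup.index_ker]
  exact Nat.mul_le_mul_left _ (AddSubgroup.card_le_card_addGroup _)

/-- **`#E(K_𝔮)[p^k]·#(𝓞_𝔮/p^k) ≤ #H¹_{𝓛, ⊤ at 𝔮}(K, E[p^k]) · ∏_{w ∣ ∞} #H¹(K_w, E(K̄_w))`** — the relaxed
Kummer count with the Kummer condition ALSO imposed at the archimedean places: the classes of
`H¹_{𝓛, ⊤ at 𝔮 and ∞}` whose images in `∏_{w∣∞} H¹(K_w, E)` vanish (local Kummer sequences at the
archimedean completions) form `H¹_{𝓛, ⊤ at 𝔮}(K, E[p^k]) = kummerOutside W (p^k) {𝔮}`, and each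
`H¹(K_w, E(K̄_w))` is FINITE (tree `H1SigmaCorank.finite_localH1_infinitePlace`, killed by `2`), so the
constant `∏_{w∣∞} #H¹(K_w, E)` is independent of `k` (and equals `1` unless `p = 2` matters through a
real place). [cite: MilneADT2006, Ch. I, Lemma 3.3, Rem. 3.7 and Thm. 4.10] [cite: GreenbergLNM1716, §4 pp. 105–106] -/
theorem natCard_kummerSelmerStructure_le_natCard_kummerOutside_singleton_mul (hk : 0 < k)
    (hPT : poitouTate_selmerStructure_duality K) (𝔮 : HeightOneSpectrum (𝓞 K)) :
    Nat.card (W.kummerSelmerStructure ((p ^ k : ℕ) : ℤ) (Sum.inr 𝔮)) ≤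
      Nat.card (kummerOutside W (p ^ k) {Sum.inr 𝔮}) *
        ∏ w : InfinitePlace K, Nat.card (galoisCohomology (W.localGaloisModule w.Completion) 1) := by
  classical
  haveI : NeZero (p ^ k) := ⟨pow_ne_zero k (Fact.out : p.Prime).ne_zero⟩
  haveI : Finite (W.geomTorsion ((p ^ k : ℕ) : ℤ)) := finite_geomTorsion_of_neZero W _
  set S' : Finset (Place K) := insert (Sum.inr 𝔮) (Finset.univ.image Sum.inl) with hS'
  set A := kummerOutside W (p ^ k) S' with hA
  haveI : Finite A := finite_kummerOutside W (p ^ k) S'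
  haveI hfinw : ∀ w : InfinitePlace K, Finite (galoisCohomology (W.localGaloisModule w.Completion) 1) :=
    fun w ↦ H1SigmaCorank.finite_localH1_infinitePlace W w
  -- the archimedean "Kummer defect" map
  let g : ∀ w : InfinitePlace K, galoisCohomology (W.torsionGaloisModule ((p ^ k : ℕ) : ℤ)) 1 →+
      galoisCohomology (W.localGaloisModule w.Completion) 1 := fun w ↦
    (galoisCohomology.map (W.torsionPointsMapIntertwining ((p ^ k : ℕ) : ℤ) w.Completion) 1).comp
      (galoisCohomology.localization (W.torsionGaloisModule ((p ^ k : ℕ) : ℤ)) (Sum.inl w) 1)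
  let f : A →+ ∀ w : InfinitePlace K, galoisCohomology (W.localGaloisModule w.Completion) 1 :=
    (AddMonoidHom.pi g).comp A.subtype
  have hf : ∀ (x : A) (w : InfinitePlace K), f x w =
      galoisCohomology.map (W.torsionPointsMapIntertwining ((p ^ k : ℕ) : ℤ) w.Completion) 1
        (galoisCohomology.localization (W.torsionGaloisModule ((p ^ k : ℕ) : ℤ)) (Sum.inl w) 1 x.1) :=
    fun _ _ ↦ rfl
  -- its kernel lies in `kummerOutside W (p^k) {𝔮}`
  have hker : ∀ x : f.ker, (x.1.1 : galoisCohomology (W.torsionGaloisModule ((p ^ k : ℕ) : ℤ)) 1) ∈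
      kummerOutside W (p ^ k) {Sum.inr 𝔮} := by
    intro x
    have hx0 : f x.1 = 0 := (AddMonoidHom.mem_ker).mp x.2
    have hxA := (mem_kummerOutside_iff W (p ^ k) S' x.1.1).mp x.1.2
    rw [mem_kummerOutside_iff]
    intro v hv
    rw [Finset.mem_singleton] at hv
    cases v with
    | inl w =>
      have h0 : f x.1 w = 0 := by rw [hx0]; rfl
      rw [hf] at h0
      exact h0
    | inr v =>
      exact hxA (Sum.inr v) (by
        rw [hS', Finset.mem_insert, not_or]
        exact ⟨hv, inr_not_mem_image_inl v⟩)
  let ι : f.ker → kummerOutside W (p ^ k) {Sum.inr 𝔮} := fun x ↦ ⟨x.1.1, hker x⟩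
  have hι : Injective ι := fun x y h ↦ by
    have h1 : (ι x).1 = (ι y).1 := congrArg Subtype.val h
    exact Subtype.ext (Subtype.ext h1)
  haveI : Finite (kummerOutside W (p ^ k) {Sum.inr 𝔮}) := finite_kummerOutside W (p ^ k) {Sum.inr 𝔮}
  haveI : Finite f.ker := Finite.of_injective ι hι
  calc Nat.card (W.kummerSelmerStructure ((p ^ k : ℕ) : ℤ) (Sum.inr 𝔮))
      ≤ Nat.card A := natCard_kummerSelmerStructure_le_natCard_kummerOutside W p k hk hPT 𝔮
    _ ≤ Nat.card f.ker * Nat.card (∀ w : InfinitePlace K, galoisCohomology (W.localGaloisModule w.Completion) 1) :=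
        natCard_le_natCard_ker_mul f
    _ ≤ Nat.card (kummerOutside W (p ^ k) {Sum.inr 𝔮}) *
        ∏ w : InfinitePlace K, Nat.card (galoisCohomology (W.localGaloisModule w.Completion) 1) := by
        rw [Nat.card_pi]
        exact Nat.mul_le_mul_right _ (Nat.card_le_card_of_injective ι hι)

/-- **`p^k ≤ #H¹_{𝓛, ⊤ at 𝔮}(K, E[p^k]) · ∏_{w ∣ ∞} #H¹(K_w, E(K̄_w))` at `𝔮 ∣ p`** — the form consumed by
the level-`0` case of the relaxed finite-level Selmer count (I1) `relaxedSelmer_torsion_card_growth`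
(constant `c(0) ⊇ ∏_{w∣∞} #H¹(K_w, E)`, independent of `k`). [cite: GreenbergLNM1716, Thm 1.7 and the paragraph after it (pp. 61–62)]
[cite: MilneADT2006, Ch. I, Thm. 4.10] -/
theorem prime_pow_le_natCard_kummerOutside_singleton_mul (hPT : poitouTate_selmerStructure_duality K)
    {𝔮 : HeightOneSpectrum (𝓞 K)} (h𝔮 : ((p : ℕ) : 𝓞 K) ∈ 𝔮.asIdeal) (k : ℕ) :
    p ^ k ≤ Nat.card (kummerOutside W (p ^ k) {Sum.inr 𝔮}) *
      ∏ w : InfinitePlace K, Nat.card (galoisCohomology (W.localGaloisModule w.Completion) 1) := by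
  haveI hfinw : ∀ w : InfinitePlace K, Finite (galoisCohomology (W.localGaloisModule w.Completion) 1) :=
    fun w ↦ H1SigmaCorank.finite_localH1_infinitePlace W w
  have hprod : 0 < ∏ w : InfinitePlace K, Nat.card (galoisCohomology (W.localGaloisModule w.Completion) 1) :=
    Finset.prod_pos fun w _ ↦ Nat.card_pos
  rcases Nat.eq_zero_or_pos k with rfl | hk
  · rw [pow_zero]
    haveI : Finite (W.geomTorsion ((1 : ℕ) : ℤ)) := finite_geomTorsion_of_neZero W _
    haveI := finite_kummerOutside W 1 ({Sum.inr 𝔮} : Finset (Place K))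
    exact Nat.mul_pos Nat.card_pos hprod
  calc p ^ k ≤ Nat.card (𝔮.adicCompletionIntegers K ⧸
        Ideal.span {((p ^ k : ℕ) : 𝔮.adicCompletionIntegers K)}) :=
        prime_pow_le_natCard_quot_adicCompletionIntegers p h𝔮 k
    _ ≤ Nat.card (nsmulAddMonoidHom (p ^ k) : (W.baseChange (𝔮.adicCompletion K)).toAffine.Point →+ _).ker *
        Nat.card (𝔮.adicCompletionIntegers K ⧸ Ideal.span {((p ^ k : ℕ) : 𝔮.adicCompletionIntegers K)}) := by
        haveI := W.finite_ker_nsmul_adicCompletion 𝔮 (pow_ne_zero k (Fact.out : p.Prime).ne_zero)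
        exact Nat.le_mul_of_pos_left _ Nat.card_pos
    _ = Nat.card (W.kummerSelmerStructure ((p ^ k : ℕ) : ℤ) (Sum.inr 𝔮)) :=
        (W.natCard_kummerSelmerStructure_inr 𝔮 (pow_ne_zero k (Fact.out : p.Prime).ne_zero)).symm
    _ ≤ _ := natCard_kummerSelmerStructure_le_natCard_kummerOutside_singleton_mul W p k hk hPT 𝔮


/-! ## The kernel of `H¹(K, E[p^M]) → H¹(K, E[p^∞])` is bounded by `#E(K̄)[p^∞]^{Γ_K}` -/

/-- **`#ker(H¹(K, E[p^M]) → H¹(K, E[p^∞])) ≤ #E(K̄)[p^∞]^{Γ_K}`** for the map induced by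
`E[p^M] ↪ E[p^∞]` (`resH1Hom (id, inclusion)`; from `0 → E[p^M] → E[p^∞] → E[p^∞] → 0` the kernel is
`δ(E[p^∞]^{Γ_K}/p^M)`): a cocycle `φ` with values in `E[p^M]` that is the coboundary of `a ∈ E[p^∞]` has
`p^M a ∈ E[p^∞]^{Γ_K}`, and `[φ] ↦ p^M a` is well defined and INJECTIVE on the kernel (`p^M a = p^M a'` puts
`a − a'` in `E[p^M]`, so `φ − φ' = ∂(a − a')` is a coboundary in `E[p^M]`). The fixed points are finite
(`finite_fixedPoints_geomPrimaryTorsion`: `E(K)_{tors}` is finite). (The tree's `SelmerLevelToPrimary` has the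
injective case `E(K̄)[p^∞]^{Γ_K} = 0` for the same map under the name `torsionPowToPrimaryH1`.)
[cite: GreenbergLNM1716, §2 (pp. 62–63) and §3 Lemma 3.1] [cite: WZhang2014, p. 248] -/
theorem finite_ker_resH1Hom_inclusion_and_natCard_le (M : ℕ) :
    Finite (resH1Hom (ContinuousMonoidHom.id (Field.absoluteGaloisGroup K))
        (AddSubgroup.inclusion
          (Literature.Barriers.BirchSwinnertonDyer.geomTorsion_pow_le_geomPrimaryTorsion W p M))
        (fun _ _ ↦ rfl) : W.galH1Torsion ((p ^ M : ℕ) : ℤ) →+ W.galH1Primary p).ker ∧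
    Nat.card (resH1Hom (ContinuousMonoidHom.id (Field.absoluteGaloisGroup K))
        (AddSubgroup.inclusion
          (Literature.Barriers.BirchSwinnertonDyer.geomTorsion_pow_le_geomPrimaryTorsion W p M))
        (fun _ _ ↦ rfl) : W.galH1Torsion ((p ^ M : ℕ) : ℤ) →+ W.galH1Primary p).ker ≤
      Nat.card {m : W.geomPrimaryTorsion p | ∀ σ : Field.absoluteGaloisGroup K, σ • m = m} := by
  classical
  set ι₁ := (resH1Hom (ContinuousMonoidHom.id (Field.absoluteGaloisGroup K))
        (AddSubgroup.inclusion
          (Literature.Barriers.BirchSwinnertonDyer.geomTorsion_pow_le_geomPrimaryTorsion W p M))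
        (fun _ _ ↦ rfl) : W.galH1Torsion ((p ^ M : ℕ) : ℤ) →+ W.galH1Primary p) with hι₁
  haveI : Finite {m : W.geomPrimaryTorsion p | ∀ σ : Field.absoluteGaloisGroup K, σ • m = m} :=
    (W.finite_fixedPoints_geomPrimaryTorsion p).to_subtype
  have hrep : ∀ y : ι₁.ker,
      ∃ φ : contOneCocycles (discreteTopRep (Field.absoluteGaloisGroup K) (W.geomTorsion ((p ^ M : ℕ) : ℤ))),
        oneCocycleClass _ φ = y.1 ∧ ∃ a : W.geomPrimaryTorsion p, ∀ σ : Field.absoluteGaloisGroup K,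
          ((φ.1 σ : W.geomTorsion ((p ^ M : ℕ) : ℤ)) : W.geomPoints) = σ • (a : W.geomPoints) - a := by
    intro y
    obtain ⟨φ, hφ⟩ := oneCocycleClass_surjective _ y.1
    have hy : ι₁ (oneCocycleClass _ φ) = 0 := by
      rw [hφ]; exact (AddMonoidHom.mem_ker).mp y.2
    rw [hι₁, CocycleCriteria.resH1Hom_oneCocycleClass_eq_zero_iff] at hy
    obtain ⟨a, ha⟩ := hy
    refine ⟨φ, hφ, a, fun σ ↦ ?_⟩
    have h := ha σ
    change AddSubgroup.inclusion
      (Literature.Barriers.BirchSwinnertonDyer.geomTorsion_pow_le_geomPrimaryTorsion W p M) (φ.1 σ) =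
        σ • a - a at h
    have h' := congrArg (fun b : W.geomPrimaryTorsion p ↦ (b : W.geomPoints)) h
    simpa only [AddSubgroup.coe_inclusion, AddSubgroupClass.coe_sub, primaryComponent.coe_smul] using h'
  choose φ hφ a ha using hrep
  -- `p^M a` is `Γ_K`-fixed
  have hfix : ∀ (y : ι₁.ker) (σ : Field.absoluteGaloisGroup K), σ • (p ^ M • a y) = p ^ M • a y := by
    intro y σ
    apply Subtype.ext
    rw [primaryComponent.coe_smul, AddSubmonoidClass.coe_nsmul, smul_comm, ← sub_eq_zero, ← smul_sub,
      ← ha y σ, ← AddSubmonoidClass.coe_nsmul, AddSubgroup.torsionBy.nsmul, ZeroMemClass.coe_zero]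
  let θ : ι₁.ker → {m : W.geomPrimaryTorsion p | ∀ σ : Field.absoluteGaloisGroup K, σ • m = m} :=
    fun y ↦ ⟨p ^ M • a y, fun σ ↦ hfix y σ⟩
  suffices hθ : Function.Injective θ from
    ⟨Finite.of_injective θ hθ, Nat.card_le_card_of_injective θ hθ⟩
  intro y y' hyy
  have h1 : p ^ M • ((a y : W.geomPoints) - a y') = 0 := by
    have h2 : p ^ M • a y = p ^ M • a y' := congrArg Subtype.val (show θ y = θ y' from hyy)
    have h3 := congrArg (fun b : W.geomPrimaryTorsion p ↦ (b : W.geomPoints)) h2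
    simp only [AddSubmonoidClass.coe_nsmul] at h3
    rw [smul_sub, h3, sub_self]
  set b : W.geomTorsion ((p ^ M : ℕ) : ℤ) :=
    ⟨(a y : W.geomPoints) - a y', AddSubgroup.torsionBy.nsmul_iff.mpr h1⟩ with hb
  have hcob : oneCocycleClass _ (φ y - φ y') = 0 := by
    refine (oneCocycleClass_eq_zero_iff _ _).mpr ⟨b, fun σ ↦ Subtype.ext ?_⟩
    change (((φ y - φ y').1 σ : W.geomTorsion ((p ^ M : ℕ) : ℤ)) : W.geomPoints) =
      (((σ • b - b : W.geomTorsion ((p ^ M : ℕ) : ℤ))) : W.geomPoints)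
    have hsub : ((φ y - φ y').1 σ : W.geomTorsion ((p ^ M : ℕ) : ℤ)) = (φ y).1 σ - (φ y').1 σ := rfl
    rw [hsub, AddSubgroupClass.coe_sub, ha y σ, ha y' σ, AddSubgroupClass.coe_sub,
      AddSubgroup.torsionBy.coe_smul, hb]
    simp only [smul_sub]
    abel
  apply Subtype.ext
  rw [← hφ y, ← hφ y', ← sub_eq_zero, ← oneCocycleClass_sub, hcob]

/-! ## From the Kummer condition at a place to the `p^∞` local kernel -/

omit [NumberField K] [W.IsElliptic] [Fact p.Prime] in
/-- **`Sel`-type local conditions pass from level `p^M` to `E[p^∞]`**: if `y ∈ H¹(K, E[p^M])` dies in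
`H¹(Γ_E, E(K̄_E))` (`selmerLocalKer W E (p^M)`, the Kummer condition at the `K`-field `E`), then its image in
`H¹(K, E[p^∞])` under `(E[p^M] ↪ E[p^∞])_*` dies there too (`selmerLocalKerPrimary W E p`): both maps to
`H¹(Γ_E, E(K̄_E))` are the maps of compatible pairs and `E[p^M] ↪ E[p^∞] ↪ E(K̄)` composes (functoriality
`resH1Hom_comp`). [cite: GreenbergLNM1716, §2 (p. 63)] -/
theorem resH1Hom_inclusion_mem_selmerLocalKerPrimary (M : ℕ) (E : Type) [Field E] [Algebra K E]
    {y : W.galH1Torsion ((p ^ M : ℕ) : ℤ)} (hy : y ∈ WeierstrassCurve.selmerLocalKer W E ((p ^ M : ℕ) : ℤ)) :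
    resH1Hom (ContinuousMonoidHom.id (Field.absoluteGaloisGroup K))
        (AddSubgroup.inclusion
          (Literature.Barriers.BirchSwinnertonDyer.geomTorsion_pow_le_geomPrimaryTorsion W p M))
        (fun _ _ ↦ rfl) y ∈ WeierstrassCurve.selmerLocalKerPrimary W E p := by
  rw [WeierstrassCurve.mem_selmerLocalKerPrimary_iff]
  have hy' := hy
  unfold WeierstrassCurve.selmerLocalKer at hy'
  rw [resKer_eq_ker, AddMonoidHom.mem_ker] at hy'
  rw [← AddMonoidHom.comp_apply, resH1Hom_comp, ← hy']
  exact DFunLike.congr_fun (resH1Hom_congr (by ext; rfl) (by ext; rfl) _ _) y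

/-! ## (I1) at level `0`: the relaxed classes in `H¹(K, E[p^∞])` in the currency of `relaxedSelmer_torsion_card_growth` -/

/-- **The LEVEL-`0` CASE of (I1) `relaxedSelmer_torsion_card_growth`, from Poitou–Tate for Selmer
structures.** For `E = W` elliptic over a number field `K` (any signature), a prime `p`, a `ℤ_p`-extension `κ`
and a finite place `v ∋ p`, GIVEN `poitouTate_selmerStructure_duality K`: there is `c` such that for every
`k` there is a finite set `F ⊆ H¹(K̄^{Γ_0}, E[p^∞])` (`Γ_0 = κ.layerSubgroup 0 = Γ_K`) of `p^k`-torsion classes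
satisfying the Selmer conditions at all places not above `v` (all conjugates, finite `u ≠ v` and infinite `w`)
with `p^{k·p⁰} ≤ c · #F`. Construction: `F` = the image of `kummerOutside W (p^k) {v} ⊆ H¹(K, E[p^k])` under
`H¹(K, E[p^k]) → H¹(K, E[p^∞]) ⥲ H¹(⊤, E[p^∞]) → H¹(Γ_0, E[p^∞])`; the count is
`prime_pow_le_natCard_kummerOutside_singleton_mul` divided by the kernel bound
`finite_ker_resH1Hom_inclusion_and_natCard_le` (`c = #E(K̄)[p^∞]^{Γ_K} · ∏_{w∣∞} #H¹(K_w, E)`); the local conditions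
transfer by `resH1Hom_inclusion_mem_selmerLocalKerPrimary`, `resH1Hom_subgroupIncl_mem_localKerOver_top_iff`,
`resOfLe_mem_localKerOver`, and `conj_σ = id` on `H¹(Γ_0, ·)` (`conjH1_of_mem_holds`, every `σ ∈ Γ_0`).
[cite: GreenbergLNM1716, Thm 1.7 and the paragraph after it (pp. 61–62)] [cite: MilneADT2006, Ch. I, Thm. 4.10]
[cite: NeukirchSchmidtWingberg2008, (8.7.9)] -/
theorem relaxedSelmer_torsion_card_levelZero_of_poitouTate (hPT : poitouTate_selmerStructure_duality K)
    (κ : ZpExtension K p) (v : HeightOneSpectrum (𝓞 K)) (hv : (p : 𝓞 K) ∈ v.asIdeal) :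
    ∃ c : ℕ, ∀ k : ℕ, ∃ F : Finset (W.subgroupH1 p (κ.layerSubgroup 0)),
      (∀ y ∈ F, p ^ k • y = 0 ∧
        (∀ u : HeightOneSpectrum (𝓞 K), u ≠ v → ∀ σ : Field.absoluteGaloisGroup K,
          W.conjH1 p (κ.layerSubgroup 0) σ y ∈
            W.localKerOver p (κ.layerSubgroup 0) (u.adicCompletion K)) ∧
        (∀ (w : InfinitePlace K) (σ : Field.absoluteGaloisGroup K),
          W.conjH1 p (κ.layerSubgroup 0) σ y ∈
            W.localKerOver p (κ.layerSubgroup 0) w.Completion)) ∧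
      p ^ (k * p ^ 0) ≤ c * F.card := by
  classical
  -- constants
  set Fix := {m : W.geomPrimaryTorsion p | ∀ σ : Field.absoluteGaloisGroup K, σ • m = m} with hFix
  haveI hFixfin : Finite Fix := (W.finite_fixedPoints_geomPrimaryTorsion p).to_subtype
  haveI hfinw : ∀ w : InfinitePlace K, Finite (galoisCohomology (W.localGaloisModule w.Completion) 1) :=
    fun w ↦ H1SigmaCorank.finite_localH1_infinitePlace W w
  set Cinf := ∏ w : InfinitePlace K, Nat.card (galoisCohomology (W.localGaloisModule w.Completion) 1) with hC
  refine ⟨Nat.card Fix * Cinf, fun k ↦ ?_⟩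
  haveI : NeZero (p ^ k) := ⟨pow_ne_zero k (Fact.out : p.Prime).ne_zero⟩
  haveI : Finite (W.geomTorsion ((p ^ k : ℕ) : ℤ)) := finite_geomTorsion_of_neZero W _
  -- the three maps
  set H₀ : Subgroup (Field.absoluteGaloisGroup K) := κ.layerSubgroup 0 with hH₀
  have hH₀top : ∀ σ : Field.absoluteGaloisGroup K, σ ∈ H₀ := fun σ ↦ by
    rw [hH₀, ZpExtension.mem_layerSubgroup, pow_zero]; exact one_dvd _
  have hle : H₀ ≤ ⊤ := le_top
  have hge : (⊤ : Subgroup (Field.absoluteGaloisGroup K)) ≤ H₀ := fun σ _ ↦ hH₀top σ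
  let ι₁ : galoisCohomology (W.torsionGaloisModule ((p ^ k : ℕ) : ℤ)) 1 →+ W.galH1Primary p :=
    resH1Hom (ContinuousMonoidHom.id (Field.absoluteGaloisGroup K))
      (AddSubgroup.inclusion
        (Literature.Barriers.BirchSwinnertonDyer.geomTorsion_pow_le_geomPrimaryTorsion W p k))
      (fun _ _ ↦ rfl)
  let ι₂ : W.galH1Primary p →+ W.subgroupH1 p ⊤ :=
    resH1Hom (Literature.NumberTheory.EllipticCurves.subgroupIncl (⊤ : Subgroup (Field.absoluteGaloisGroup K)))
      (AddMonoidHom.id (W.geomPrimaryTorsion p)) (fun _ _ ↦ rfl)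
  let ι₃ : W.subgroupH1 p ⊤ →+ W.subgroupH1 p H₀ := W.resOfLe p hle
  let Φ : galoisCohomology (W.torsionGaloisModule ((p ^ k : ℕ) : ℤ)) 1 →+ W.subgroupH1 p H₀ :=
    ι₃.comp (ι₂.comp ι₁)
  have hΦ : ∀ x, Φ x = ι₃ (ι₂ (ι₁ x)) := fun _ ↦ rfl
  have hι₂ : Function.Injective ι₂ := (bijective_resH1Hom_subgroupIncl _ ⊤ Subgroup.mem_top).1
  have hι₃ : Function.Injective ι₃ := resOfLe_injective_of_ge (W.geomPrimaryTorsion p) hle hge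
  -- the source: relaxed Kummer classes at level `p^k`
  set KO := kummerOutside W (p ^ k) ({Sum.inr v} : Finset (Place K)) with hKO
  haveI hKOfin : Finite KO := finite_kummerOutside W (p ^ k) {Sum.inr v}
  have hKOfin' : (KO : Set (galoisCohomology (W.torsionGaloisModule ((p ^ k : ℕ) : ℤ)) 1)).Finite :=
    Set.toFinite _
  set s : Finset (galoisCohomology (W.torsionGaloisModule ((p ^ k : ℕ) : ℤ)) 1) := hKOfin'.toFinset with hs
  have hsmem : ∀ x, x ∈ s ↔ x ∈ KO := fun x ↦ by rw [hs, Set.Finite.mem_toFinset]; rfl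
  refine ⟨s.image Φ, fun y hy ↦ ?_, ?_⟩
  · obtain ⟨x, hx, rfl⟩ := Finset.mem_image.mp hy
    have hxKO : x ∈ KO := (hsmem x).mp hx
    have hxloc := (mem_kummerOutside_iff W (p ^ k) {Sum.inr v} x).mp hxKO
    -- local kernels at every place `≠ v`
    have hker : ∀ pl : Place K, pl ≠ Sum.inr v →
        ι₂ (ι₁ x) ∈ W.localKerOver p ⊤ (Place.Completion pl) := by
      intro pl hpl
      rw [WeierstrassCurve.resH1Hom_subgroupIncl_mem_localKerOver_top_iff]
      refine resH1Hom_inclusion_mem_selmerLocalKerPrimary W p k (Place.Completion pl) ?_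
      have h1 := hxloc pl (by rwa [Finset.mem_singleton])
      rw [← W.comap_res_kummerLocalConditionAt ((p ^ k : ℕ) : ℤ) (Place.Completion pl)]
      exact h1
    have hconj : ∀ σ : Field.absoluteGaloisGroup K, W.conjH1 p H₀ σ (Φ x) = Φ x := fun σ ↦ by
      rw [W.conjH1_of_mem_holds p H₀ (hH₀top σ), AddMonoidHom.id_apply]
    refine ⟨?_, fun u hu σ ↦ ?_, fun w σ ↦ ?_⟩
    · have hx0 : p ^ k • x = 0 :=
        nsmul_continuousCohomology_one_eq_zero _ (p ^ k)
          (fun T : W.geomTorsion ((p ^ k : ℕ) : ℤ) ↦ AddSubgroup.torsionBy.nsmul T) x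
      rw [← map_nsmul, hx0, map_zero]
    · rw [hconj, hΦ]
      exact W.resOfLe_mem_localKerOver p _ hle
        (hker (Sum.inr u) (fun h ↦ hu (Sum.inr_injective h)))
    · rw [hconj, hΦ]
      exact W.resOfLe_mem_localKerOver p _ hle (hker (Sum.inl w) Sum.inl_ne_inr)
  · -- the count: `p^k ≤ #KO · C∞`, `#KO ≤ #(ker ι₁) · #image` (fibres = cosets of `ker ι₁`), `#ker ι₁ ≤ #Fix`
    rw [pow_zero, mul_one]
    obtain ⟨hkerfin, hkerle⟩ := finite_ker_resH1Hom_inclusion_and_natCard_le W p k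
    haveI : Finite ι₁.ker := hkerfin
    have hkerle' : Nat.card ι₁.ker ≤ Nat.card Fix := hkerle
    have hcount : p ^ k ≤ Nat.card KO * Cinf :=
      prime_pow_le_natCard_kummerOutside_singleton_mul W p hPT hv k
    have hscard : s.card = Nat.card KO := by
      rw [hs, ← Set.ncard_eq_toFinset_card _ hKOfin']
      exact (Nat.card_coe_set_eq _).symm
    -- fibre bound
    have hfib : ∀ b ∈ s.image Φ, (s.filter fun x ↦ Φ x = b).card ≤ Nat.card ι₁.ker := by
      intro b hb
      obtain ⟨x₀, -, rfl⟩ := Finset.mem_image.mp hb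
      rw [← Nat.card_eq_finsetCard]
      refine Nat.card_le_card_of_injective
        (fun x ↦ (⟨x.1 - x₀, ?_⟩ : ι₁.ker)) ?_
      · have hx := (Finset.mem_filter.mp x.2).2
        have h1 : ι₁ x.1 = ι₁ x₀ := hι₂ (hι₃ (by rw [← hΦ, ← hΦ, hx]))
        exact (AddMonoidHom.mem_ker).mpr (by rw [map_sub, h1, sub_self])
      · intro x y h
        have h1 : x.1 - x₀ = y.1 - x₀ := congrArg Subtype.val h
        exact Subtype.ext (sub_left_injective h1)
    have hsle : s.card ≤ Nat.card ι₁.ker * (s.image Φ).card := Finset.card_le_mul_card_image s _ hfib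
    calc p ^ k ≤ Nat.card KO * Cinf := hcount
      _ = s.card * Cinf := by rw [hscard]
      _ ≤ Nat.card ι₁.ker * (s.image Φ).card * Cinf := Nat.mul_le_mul_right _ hsle
      _ ≤ Nat.card Fix * (s.image Φ).card * Cinf :=
          Nat.mul_le_mul_right _ (Nat.mul_le_mul_right _ hkerle')
      _ = Nat.card Fix * Cinf * (s.image Φ).card := by ring

end Summit.BirchSwinnertonDyer.BirchSwinnertonDyer.Theorems.SignedEC.RelaxedKummerCount

end
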